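import Literature.NumberTheory.ComplexMultiplication.FiniteQAlgebraLatticePowersInvertible
import Literature.NumberTheory.QuadraticForms.DualLatticeIdentities
import Mathlib.RingTheory.Adjoin.PowerBasis
import Mathlib.RingTheory.Polynomial.GaussLemma
import Mathlib.RingTheory.Localization.Integral
import HarnessLib

/-!
# DUAL LATTICES `L^φ` UNDER A MULTIPLICATIVE METRIC `φ` of an ARBITRARY finite-dimensional commutative `ℚ`-algebra
# `A`: Faddeev's calculus `L^φφ = L`, `(L_1L_2)^φ = L_1^φ : L_2`, `𝒪(L^φ) = 𝒪(L)`, `L·L^φ = 𝒪(L)^φ`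
# (Hertling–Larabi 2026b Lemma 4.13), THEOREM 4.14 «every `L` with `𝒪(L) = Λ` is invertible ⟺ `Λ^φ` is invertible
# ⟺ `𝒪((Λ^φ)²) = Λ`», Lemma 4.11 and THEOREM 4.12 «over a CYCLIC order `Λ = ℤ[a]` every full lattice `L` with
# `𝒪(L) = Λ` is invertible» — nilpotents allowed

[topic NumberTheory/ComplexMultiplication] General-`A` series (namespace
`Literature.NumberTheory.ComplexMultiplication.FiniteQAlgebraLattice`), sequel of `FiniteQAlgebraLatticePowersInvertible`
(the semigroup `𝓛(A)` of full lattices of a finite-dimensional commutative `ℚ`-algebra `A`: `M·N`, `M:N = M / N`,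
`𝒪(M) = M / M`, invertibility `M·(𝒪(M):M) = 𝒪(M)`) and of `FiniteQAlgebraLatticeMaximalOrderInvertible` (Thm. 4.3 (b)
(iv) ⟹ (i) for SEPARABLE `A` only).  Lane `lit-hodgefound` (Track 2 foundations library), seat p19 generation 36, row
g36-#1.  THEOREMS ONLY: no definition, no instance, no notation, no named fact (D-0026, net Literature debt `0`), no
`sorry`.  The multiplicative metric is a Mathlib bilinear form `φ : LinearMap.BilinForm ℚ A` with
`φ (a * b) c = φ a (b * c)`; the dual lattice `L^φ` of the source is Mathlib's `φ.dualSubmodule L`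
(`LinearMap.BilinForm.dualSubmodule`; Mathlib pairs the variable on the LEFT, the source on the right — the same set,
`φ` being symmetric, `mem_dualSubmodule_iff_right`); the metric «induced via (3.2) by a linear form `l`» is
`(LinearMap.mul ℚ A).compr₂ l`, i.e. `(a, b) ↦ l(ab)`; a cyclic order `ℤ[a]` is
`Subalgebra.toSubmodule (Algebra.adjoin ℤ {a})`.

## Sources, VERBATIM

C. Hertling, K. Larabi, *Conjugacy classes of regular integer matrices*, arXiv:2602.15748 (2026)
[HertlingLarabi2026b], held `paper:arxiv-2602.15748`.  §3 (chunk p0006): «Throughout the paper `A` is a finite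
dimensional commutative ℚ-algebra with unit element `1_A`. […] **Definition 3.3.** […] (a) `A` is called cyclic if it
contains an element `a` with `A = ℚ[a]`. (b) A symmetric ℚ-bilinear form `Φ : A × A → ℚ` is multiplication invariant
if `Φ(ab, c) = Φ(a, bc)` for `a, b, c ∈ A`. A symmetric ℚ-bilinear form which is multiplication invariant and
nondegenerate is called multiplicative metric. […] **Remarks 3.4.** (i) […] any ℚ-linear form `l : A → ℚ` with
`Ann_{A^{(j)}}(N^{(j)}) ⊄ ker(l)` […] gives rise to a multiplicative metric via `φ(a, b) := l(ab)` (3.2), and any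
multiplicative metric is constructed in this way. (ii) Any cyclic algebra is Gorenstein. If `A = ℚ[a]`, then the
linear form `l : A → ℚ` with `l(a^m) = 0` for `m ∈ {0, 1, ..., dim A − 2}`, `l(a^{dim A−1}) = 1` gives rise to a
multiplicative metric by (3.2).»
§4 (chunk p0007): «**Definition 4.1.** […] (b) An order in `A` is a full lattice `Λ` in `A` with `1_A ∈ Λ` and
`Λ·Λ ⊂ Λ` […] **Theorem 4.3 (DTZ62).** [Fa65-1] [HL26] […] (b) Let `L ∈ 𝓛(A)`. The following four properties are
equivalent: (i) `L` is invertible in the semigroup `𝓛(A)`. (ii) `L_2 ∈ 𝓛(A)` with `L·L_2 = 𝒪(L)` exists.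
(iii) `L·(𝒪(L):L) = 𝒪(L)`. (iv) `𝒪(𝒪(L):L) = 𝒪(L)`.» («with one piece from [Fa65-1] (the implication (iv)⟹(i) in
Theorem 4.3 (b))»).
§4 (chunk p0008): «**Definition 4.10.** (a) An order `Λ` in `A` is cyclic if an `a ∈ Λ` with `Λ = ℤ[a]` exists.
(c) Let `φ : A × A → ℚ` be a multiplicative metric. For `L ∈ 𝓛(A)` denote by `L^φ` the full lattice
`L^φ := {b ∈ A | φ(a, b) ∈ ℤ ∀ a ∈ L}`. The following properties are elementary. **Lemma 4.11.** (a) (i) If `Λ` is a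
cyclic order `Λ = ℤ[a]` in `A` then also `A` is cyclic, namely `A = ℚ[a]`. (ii) Vice versa, any cyclic algebra `A`
contains cyclic orders. (b) If `Λ = ℤ[a]` is a cyclic order in `A`, then the multiplicative metric of `A = ℚ[a]`
which is induced via (3.2) by the linear form `l : A → ℚ` in Remark 3.4 (ii) satisfies `Λ^φ = Λ`.
**Theorem 4.12.** Let `Λ` be a cyclic order in `A`. Then each `L ∈ 𝓛(A)` with `𝒪(L) = Λ` is invertible. Proof: In
the case of separable `A`, Theorem 4.12 is due to Faddeev [Fa65-1]. The general case follows from Lemma 4.11 (b) and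
Theorem 4.14 (ii)⟹(i). □ […] **Lemma 4.13 (Fa65-1).** Let `φ : A × A → ℚ` be a multiplicative metric. Fix
`L_1, L_2 ∈ 𝓛(A)`. Then `L_1^{φφ} = L_1` (4.4), `(L_1 + L_2)^φ = L_1^φ ∩ L_2^φ` (4.5), `(L_1 ∩ L_2)^φ = L_1^φ + L_2^φ`
(4.6), `(L_1L_2)^φ = L_1^φ : L_2 (= L_2^φ : L_1)` (4.7), `𝒪(L_1^φ) = 𝒪(L_1)` (4.8), `L_1L_1^φ = 𝒪(L_1)^φ` (4.9). […]
**Theorem 4.14.** Let `A` have a multiplicative metric `φ`. Let `Λ ∈ 𝓛(A)` be an order. The conditions (i), (ii)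
and (iii) are equivalent. (i) Each `L ∈ 𝓛(A)` with `𝒪(L) = Λ` is invertible. (ii) `Λ^φ` is invertible.
(iii) `𝒪((Λ^φ)²) = Λ`. Proof: (i)⟹(ii): `𝒪(Λ^φ) = 𝒪(Λ) = Λ` by (4.8), so by (i) `Λ^φ` is invertible. (ii)⟹(i):
Consider `L ∈ 𝓛(A)` with `𝒪(L) = Λ`. `L(L^φ(Λ^φ)⁻¹) = Λ^φ(Λ^φ)⁻¹ = 𝒪(Λ^φ) = 𝒪(Λ) = Λ = 𝒪(L)` by (4.9), (4.8), so
`L` is invertible. (ii)⟺(iii): Consider `L_1 := Λ^φ`. `𝒪(L_1) = 𝒪(Λ^φ) = 𝒪(Λ) = Λ`, and thus `𝒪(L_1)^φ = Λ^φ`,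
so `𝒪(Λ^φΛ^φ) = 𝒪(𝒪(L_1)^φ L_1) = 𝒪((𝒪(L_1):L_1)^φ) = 𝒪(𝒪(L_1):L_1)` by (4.7), (4.8). Theorem 4.3 (b) (i)⟺(iv)
gives the equivalence (ii)⟺(iii). □»

C. Hertling, K. Larabi, *Semigroups from full lattices in commutative ℚ-algebras*, arXiv:2602.14973 (2026)
[HertlingLarabi2026], held `paper:arxiv-2602.14973`, §5 (chunks p0011–p0012): «**Lemma 5.2.** […] (c) (Krull's
lemma) Let `Λ` be a full lattice with `Λ·Λ ⊂ Λ` and `Λ·L = L` for some full lattice `L`. Then `1_A ∈ Λ`, so `Λ` is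
an order.»; Thm. 5.6 (c) (v) ⟹ (i) (the dualising proof: `L_1 := L(𝒪(L):L)` satisfies `L_1² ⊂ L_1` (5.6),
`𝒪(L) : L_1 = 𝒪(L)` (5.8), hence `L_1·L_3^{*ℤ} = L_3^{*ℤ}` (5.7) for `L_3 = 𝒪(L)`, and Krull's lemma gives
`1_A ∈ L_1`).

## What is formalised (`M`, `N`, `Λ : Submodule ℤ A`; `M^φ := φ.dualSubmodule M`; `hφ : ∀ a b c, φ (a * b) c = φ a (b * c)`)

* §0 the bridge `IsFullLattice A M ⟺ M.IsLattice ℚ` between the series' full lattices and Mathlib's lattices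
  (`isLattice_of_isFullLattice`, `isFullLattice_of_isLattice`), so that O'Meara's §82F calculus of the tree
  (`Literature.NumberTheory.QuadraticForms.DualLattice`, any nondegenerate symmetric form over a PID) applies.
* §1 DEFINITION 3.3 (b) ∕ REMARK 3.4 (i): multiplication invariance implies symmetry (`isSymm_of_map_mul`) and
  `φ(a, b) = l(ab)` with `l = φ(1, ·)` (`eq_compr₂_apply_one`); conversely every `l(ab)` is multiplication invariant
  (`compr₂_mul_map_mul`).
* §2 DEFINITION 4.10 (c) and LEMMA 4.13 [Fa65-1]: `mem_dualSubmodule_iff(_right)`, **`isFullLattice_dualSubmodule`**,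
  (4.4) **`dualSubmodule_dualSubmodule`**, `dualSubmodule_le_dualSubmodule_iff`, `dualSubmodule_inj`, (4.6)
  `dualSubmodule_inf` — these four BY NAME from O'Meara §82F in the tree ((4.5) is literally the tree's
  `QuadraticForms.DualLattice.dualSubmodule_sup`, not restated) —, (4.7) **`dualSubmodule_mul`** (no fullness, no
  nondegeneracy), `div_eq_dualSubmodule`, `dualSubmodule_div`, (4.8) **`div_self_dualSubmodule`**, (4.9)
  **`mul_dualSubmodule_eq`**, and `(uM)^φ = u⁻¹M^φ` (`dualSubmodule_units_smul`).
* §3 KRULL'S LEMMA for general `A` (`one_mem_of_mul_le_of_mul_eq`) and THEOREM 4.3 (b): (iii) ⟹ (iv) in any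
  commutative ring (`div_div_div_eq_of_mul_div_div_eq`) and **(iv) ⟹ (iii) for every `A` carrying a multiplicative
  metric** (`mul_div_div_eq_of_div_div_div_eq`: Hertling–Larabi's proof of Thm. 5.6 (c) (v) ⟹ (i) with `L^φ` in
  place of `L^{*ℤ}`; the tree had it for `Y = ∏ Lᵢ` under the trace form and, by transport, for reduced `A`),
  `mul_div_div_eq_iff_div_div_div_eq`.
* §4 THEOREM 4.14: (i) ⟹ (ii) `dualSubmodule_mul_div_eq_of_forall_mul_div_eq`, (ii) ⟹ (i)
  **`mul_div_eq_of_dualSubmodule_mul_div_eq`**, (i) ⟺ (ii) `forall_mul_div_eq_iff_dualSubmodule_mul_div_eq`,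
  (ii) ⟺ (iii) **`dualSubmodule_mul_div_eq_iff_div_self_sq_eq`** («`Λ^φ` invertible» is written
  `Λ^φ·(Λ:Λ^φ) = Λ`, as `𝒪(Λ^φ) = Λ`: `div_self_dualSubmodule_eq_of_one_mem`).
* §5 CYCLIC ORDERS: REMARK 3.4 (ii) (`coord_last_pow`, `coord_last_mul_pow`,
  **`nondegenerate_compr₂_coord_last`**: for a power basis `e_i = a^i`, `0 ≤ i ≤ n`, the form `l(xy)`, `l = e_n^*`, is
  nondegenerate), LEMMA 4.11 (a)(i) `adjoin_eq_top_of_isFullLattice_adjoin` (`ℤ[a]` full ⟹ `ℚ[a] = A`), (a)(ii)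
  `exists_isFullLattice_adjoin_zsmul` (`ℚ[a] = A` ⟹ `ℤ[ka]` is a full lattice for some `k ∈ ℤ ∖ 0`),
  `exists_basis_pow_span_eq` (`ℤ[a]` full ⟹ `ℤ[a] = ⊕_{i=0}^{n} ℤa^i` on a `ℚ`-basis of `A`, `n + 1 = dim A`; Gauss's
  lemma for the `ℚ`-minimal polynomial), LEMMA 4.11 (b) **`dualSubmodule_span_pow_eq`** ∕ `dualSubmodule_adjoin_eq`
  (`Λ^φ = Λ`), and THEOREM 4.12 **`mul_div_eq_of_div_self_eq_adjoin`** ∕ `mul_div_div_eq_of_div_self_eq_adjoin`.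
NOT here: Theorem 4.9 (BF65), Corollary 4.15 (`dim A = 2`), Remark 3.4 (i)'s socle criterion for WHICH `l` give
metrics on a non-cyclic Gorenstein `A`.

## References
* [HertlingLarabi2026b] C. Hertling, K. Larabi, arXiv:2602.15748 (2026), §3 Def. 3.3, Rem. 3.4 (chunk p0006); §4
  Def. 4.1, Thm. 4.3 (chunk p0007); Def. 4.10, Lemma 4.11, Thm. 4.12, Lemma 4.13, Thm. 4.14 (chunk p0008).
  [cite: HertlingLarabi2026b, §4 Thm. 4.12 and Thm. 4.14, chunk p0008]
* [Faddeev1965] D. K. Faddeev, *An introduction to the multiplicative theory of modules of integral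
  representations*, Trudy Mat. Inst. Steklov 80 (1965) 145–182 (= [Fa65-1]: Lemma 4.13, Thm. 4.14 for separable `A`,
  Thm. 4.3 (b) (iv) ⟹ (i), as cited by HL26b). [cite: Faddeev1965, as cited by HertlingLarabi2026b §4 Lemma 4.13 ∕ Thm. 4.14]
* [HertlingLarabi2026] C. Hertling, K. Larabi, arXiv:2602.14973 (2026), §5 Lemma 5.2 (c), Thm. 5.6 (c)
  (chunks p0011–p0012). [cite: HertlingLarabi2026, §5 Lemma 5.2 (c) and Thm. 5.6 (c), chunks p0011–p0012]
* [DadeTausskyZassenhaus1962] E. C. Dade, O. Taussky, H. Zassenhaus, Math. Ann. 148 (1962) 31–64 («(DTZ62)» of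
  Thm. 4.3; Krull's lemma). [cite: DadeTausskyZassenhaus1962, §1 (as cited by HertlingLarabi2026b Thm. 4.3)]
* [Omeara1963] O. T. O'Meara, *Introduction to Quadratic Forms* (1963), §82F (the dual of a lattice; tree file
  `QuadraticForms/DualLatticeIdentities`). [cite: Omeara1963, §82F (pp. 230–231)]
-/

noncomputable section

open scoped Classical Pointwise Polynomial nonZeroDivisors
open Submodule Module Polynomial
open Literature.NumberTheory.Automorphic (IsFullLattice isFullLattice_span_of_basis mem_units_smul_submodule_iff)
open Literature.NumberTheory.QuadraticForms.DualLattice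

namespace Literature.NumberTheory.ComplexMultiplication.FiniteQAlgebraLattice

variable {A : Type} [CommRing A] [Algebra ℚ A]

/-! ## §0 Full lattices of the series are Mathlib's `ℚ`-lattices -/

/-- A full lattice `M` (finitely generated, every `d ∈ A` has `nd ∈ M` for some `n ∈ ℤ ∖ 0`) is a lattice in
Mathlib's sense: finitely generated with `ℚM = A` («A full lattice in `V` is a finitely generated ℤ-module in `V`
which generates `V` over ℚ»). [cite: HertlingLarabi2026b, §4 Def. 4.1 (a), chunk p0007] -/
theorem isLattice_of_isFullLattice {M : Submodule ℤ A} (hM : IsFullLattice A M) : M.IsLattice ℚ := by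
  refine ⟨hM.1, eq_top_iff.2 fun d _ => ?_⟩
  obtain ⟨n, hn, hnd⟩ := hM.2 d
  have hd : d = (n : ℚ)⁻¹ • (n • d) := by
    rw [← Int.cast_smul_eq_zsmul ℚ n d, smul_smul, inv_mul_cancel₀ (Int.cast_ne_zero.2 hn), one_smul]
  rw [hd]
  exact Submodule.smul_mem _ _ (Submodule.subset_span hnd)

/-- Conversely a Mathlib `ℚ`-lattice `M ⊂ A` (finitely generated, `ℚM = A`) is a full lattice of the series: it is
`⊕ ℤbⱼ` on a `ℚ`-basis `b` of `A`. [cite: HertlingLarabi2026b, §4 Def. 4.1 (a), chunk p0007] -/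
theorem isFullLattice_of_isLattice (M : Submodule ℤ A) [M.IsLattice ℚ] : IsFullLattice A M := by
  obtain ⟨b, hb⟩ := QuadraticForms.SelfDualUpToScalar.exists_basis_span_eq_of_isLattice (K := ℚ) M
  rw [← hb]
  exact isFullLattice_span_of_basis b

/-! ## §1 Multiplicative metrics (Definition 3.3 (b), Remark 3.4 (i)) -/

variable {φ : LinearMap.BilinForm ℚ A}

/-- **DEFINITION 3.3 (b): a multiplication invariant bilinear form `φ(ab, c) = φ(a, bc)` is symmetric** —
`φ(x, y) = φ(1, xy) = φ(1, yx) = φ(y, x)` (the source puts symmetry into the definition; over a commutative `A`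
with `1_A` it is automatic). [cite: HertlingLarabi2026b, §3 Def. 3.3 (b), chunk p0006] -/
theorem isSymm_of_map_mul (hφ : ∀ a b c : A, φ (a * b) c = φ a (b * c)) : φ.IsSymm :=
  ⟨fun x y => by
    have h1 : φ x y = φ 1 (x * y) := by rw [← hφ, one_mul]
    have h2 : φ y x = φ 1 (y * x) := by rw [← hφ, one_mul]
    rw [h1, h2, mul_comm]⟩

/-- **REMARK 3.4 (i), «any multiplicative metric is constructed in this way»: `φ(a, b) = l(ab)` for the linear form
`l = φ(1_A, ·)`** (`(LinearMap.mul ℚ A).compr₂ l` is the form `(a, b) ↦ l(ab)` of (3.2)).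
[cite: HertlingLarabi2026b, §3 Rem. 3.4 (i) (3.2), chunk p0006] -/
theorem eq_compr₂_apply_one (hφ : ∀ a b c : A, φ (a * b) c = φ a (b * c)) :
    φ = (LinearMap.mul ℚ A).compr₂ (φ 1) := by
  refine LinearMap.ext fun a => LinearMap.ext fun b => ?_
  rw [LinearMap.compr₂_apply, LinearMap.mul_apply', ← hφ, one_mul]

/-- **REMARK 3.4 (i), (3.2): for every linear form `l : A → ℚ` the form `φ(a, b) := l(ab)` is multiplication
invariant**, `l((ab)c) = l(a(bc))`. [cite: HertlingLarabi2026b, §3 Rem. 3.4 (i) (3.2), chunk p0006] -/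
theorem compr₂_mul_map_mul (l : A →ₗ[ℚ] ℚ) (a b c : A) :
    (LinearMap.mul ℚ A).compr₂ l (a * b) c = (LinearMap.mul ℚ A).compr₂ l a (b * c) := by
  simp only [LinearMap.compr₂_apply, LinearMap.mul_apply', mul_assoc]

/-! ## §2 Dual lattices `L^φ` (Definition 4.10 (c)) and Lemma 4.13 [Fa65-1] -/

/-- **DEFINITION 4.10 (c), membership in `L^φ`** (Mathlib's pairing, variable on the left): `b ∈ L^φ ⟺ φ(b, a) ∈ ℤ`
for all `a ∈ L`. [cite: HertlingLarabi2026b, §4 Def. 4.10 (c), chunk p0008] -/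
theorem mem_dualSubmodule_iff {M : Submodule ℤ A} {b : A} :
    b ∈ φ.dualSubmodule M ↔ ∀ a ∈ M, ∃ k : ℤ, (k : ℚ) = φ b a := by
  rw [LinearMap.BilinForm.mem_dualSubmodule]
  refine forall₂_congr fun a _ => ?_
  rw [Submodule.mem_one]
  exact exists_congr fun k => by rw [eq_intCast]

/-- **DEFINITION 4.10 (c) as printed: `L^φ = {b ∈ A | φ(a, b) ∈ ℤ ∀ a ∈ L}`** (variable on the right; the same set for
a multiplication invariant, hence symmetric, `φ`). [cite: HertlingLarabi2026b, §4 Def. 4.10 (c), chunk p0008] -/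
theorem mem_dualSubmodule_iff_right (hφ : ∀ a b c : A, φ (a * b) c = φ a (b * c)) {M : Submodule ℤ A} {b : A} :
    b ∈ φ.dualSubmodule M ↔ ∀ a ∈ M, ∃ k : ℤ, (k : ℚ) = φ a b := by
  rw [mem_dualSubmodule_iff]
  refine forall₂_congr fun a _ => exists_congr fun k => ?_
  rw [(isSymm_of_map_mul hφ).eq b a]

/-- **`L^φ` is a full lattice for a full lattice `L` and a nondegenerate `φ`** («denote by `L^φ` the full lattice
…»): by name from O'Meara §82F in the tree («this also shows that `L^#` is a lattice»,
`QuadraticForms.DualLattice.isLattice_dualSubmodule`) through the bridge of §0.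
[cite: HertlingLarabi2026b, §4 Def. 4.10 (c), chunk p0008] [cite: Omeara1963, §82F (p. 231)] -/
theorem isFullLattice_dualSubmodule (hnd : φ.Nondegenerate) {M : Submodule ℤ A} (hM : IsFullLattice A M) :
    IsFullLattice A (φ.dualSubmodule M) := by
  haveI := isLattice_of_isFullLattice hM
  haveI := isLattice_dualSubmodule hnd M
  exact isFullLattice_of_isLattice _

/-- **LEMMA 4.13 (4.4) [Fa65-1]: `L^{φφ} = L`** for a full lattice `L` and a multiplicative metric `φ` — by name
from O'Meara §82F in the tree («`L^## = L`», `QuadraticForms.DualLattice.dualSubmodule_dualSubmodule_of_isSymm`).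
[cite: HertlingLarabi2026b, §4 Lemma 4.13 (4.4), chunk p0008] [cite: Omeara1963, §82F (p. 231)] -/
theorem dualSubmodule_dualSubmodule (hnd : φ.Nondegenerate) (hφ : ∀ a b c : A, φ (a * b) c = φ a (b * c))
    {M : Submodule ℤ A} (hM : IsFullLattice A M) : φ.dualSubmodule (φ.dualSubmodule M) = M := by
  haveI := isLattice_of_isFullLattice hM
  exact dualSubmodule_dualSubmodule_of_isSymm hnd (isSymm_of_map_mul hφ) M

/-- `M^φ ⊂ N^φ ⟺ N ⊂ M` for full lattices (consequence of (4.4); O'Meara «`L ⊇ K ⇒ L^# ⊆ K^#`» and «`L^## = L`»,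
`QuadraticForms.DualLattice.dualSubmodule_le_dualSubmodule_iff_of_isSymm`).
[cite: HertlingLarabi2026b, §4 Lemma 4.13 (4.4), chunk p0008] [cite: Omeara1963, §82F (p. 231)] -/
theorem dualSubmodule_le_dualSubmodule_iff (hnd : φ.Nondegenerate) (hφ : ∀ a b c : A, φ (a * b) c = φ a (b * c))
    {M N : Submodule ℤ A} (hM : IsFullLattice A M) (hN : IsFullLattice A N) :
    φ.dualSubmodule M ≤ φ.dualSubmodule N ↔ N ≤ M := by
  haveI := isLattice_of_isFullLattice hM
  haveI := isLattice_of_isFullLattice hN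
  exact dualSubmodule_le_dualSubmodule_iff_of_isSymm hnd (isSymm_of_map_mul hφ) M N

/-- `M^φ = N^φ ⟹ M = N` for full lattices (consequence of (4.4)). [cite: HertlingLarabi2026b, §4 Lemma 4.13 (4.4), chunk p0008] -/
theorem dualSubmodule_inj (hnd : φ.Nondegenerate) (hφ : ∀ a b c : A, φ (a * b) c = φ a (b * c))
    {M N : Submodule ℤ A} (hM : IsFullLattice A M) (hN : IsFullLattice A N)
    (h : φ.dualSubmodule M = φ.dualSubmodule N) : M = N := by
  rw [← dualSubmodule_dualSubmodule hnd hφ hM, h, dualSubmodule_dualSubmodule hnd hφ hN]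

/-- **LEMMA 4.13 (4.6) [Fa65-1]: `(L_1 ∩ L_2)^φ = L_1^φ + L_2^φ`** for full lattices — by name from O'Meara §82F in
the tree (`QuadraticForms.DualLattice.dualSubmodule_inf_of_isSymm`; (4.5) `(L_1 + L_2)^φ = L_1^φ ∩ L_2^φ`, valid
without any hypothesis, is the tree's `QuadraticForms.DualLattice.dualSubmodule_sup`).
[cite: HertlingLarabi2026b, §4 Lemma 4.13 (4.5)–(4.6), chunk p0008] [cite: Omeara1963, §82F (p. 231)] -/
theorem dualSubmodule_inf (hnd : φ.Nondegenerate) (hφ : ∀ a b c : A, φ (a * b) c = φ a (b * c))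
    {M N : Submodule ℤ A} (hM : IsFullLattice A M) (hN : IsFullLattice A N) :
    φ.dualSubmodule (M ⊓ N) = φ.dualSubmodule M ⊔ φ.dualSubmodule N := by
  haveI := isLattice_of_isFullLattice hM
  haveI := isLattice_of_isFullLattice hN
  exact dualSubmodule_inf_of_isSymm hnd (isSymm_of_map_mul hφ) M N

/-- **LEMMA 4.13 (4.7) [Fa65-1]: `(L_1L_2)^φ = L_1^φ : L_2`** — `φ(b, mn) ∈ ℤ ∀ m, n ⟺ φ(bn, m) ∈ ℤ ∀ m, n`
by multiplication invariance; NO fullness and NO nondegeneracy needed. [cite: HertlingLarabi2026b, §4 Lemma 4.13 (4.7), chunk p0008] -/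
theorem dualSubmodule_mul (hφ : ∀ a b c : A, φ (a * b) c = φ a (b * c)) (M N : Submodule ℤ A) :
    φ.dualSubmodule (M * N) = φ.dualSubmodule M / N := by
  ext b
  rw [Submodule.mem_div_iff_forall_mul_mem, LinearMap.BilinForm.mem_dualSubmodule]
  constructor
  · intro h n hn
    rw [LinearMap.BilinForm.mem_dualSubmodule]
    intro m hm
    have h1 := h (m * n) (Submodule.mul_mem_mul hm hn)
    rwa [mul_comm m n, ← hφ] at h1
  · intro h y hy
    refine Submodule.mul_induction_on hy (fun m hm n hn => ?_) (fun x z hx hz => ?_)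
    · have h1 := h n hn
      rw [LinearMap.BilinForm.mem_dualSubmodule] at h1
      have h2 := h1 m hm
      rwa [hφ, mul_comm n m] at h2
    · rw [map_add]
      exact Submodule.add_mem _ hx hz

/-- **`L_3 : L_1 = (L_3^φ·L_1)^φ`** (dual form of (4.7), `L_3` full). [cite: HertlingLarabi2026b, §4 Lemma 4.13 (4.4) and (4.7), chunk p0008] -/
theorem div_eq_dualSubmodule (hnd : φ.Nondegenerate) (hφ : ∀ a b c : A, φ (a * b) c = φ a (b * c))
    {M : Submodule ℤ A} (hM : IsFullLattice A M) (N : Submodule ℤ A) :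
    M / N = φ.dualSubmodule (φ.dualSubmodule M * N) := by
  rw [dualSubmodule_mul hφ, dualSubmodule_dualSubmodule hnd hφ hM]

/-- **`(L_3 : L_1)^φ = L_3^φ·L_1`** (dual form of (4.7), `L_1`, `L_3` full). [cite: HertlingLarabi2026b, §4 Lemma 4.13 (4.4) and (4.7), chunk p0008] -/
theorem dualSubmodule_div (hnd : φ.Nondegenerate) (hφ : ∀ a b c : A, φ (a * b) c = φ a (b * c))
    {M N : Submodule ℤ A} (hM : IsFullLattice A M) (hN : IsFullLattice A N) :
    φ.dualSubmodule (M / N) = φ.dualSubmodule M * N := by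
  rw [div_eq_dualSubmodule hnd hφ hM N,
    dualSubmodule_dualSubmodule hnd hφ (isFullLattice_mul (isFullLattice_dualSubmodule hnd hM) hN)]

/-- **LEMMA 4.13 (4.8) [Fa65-1]: `𝒪(L^φ) = 𝒪(L)`** — `L^φ : L^φ = (L·L^φ)^φ = (L^φ·L)^φ = L^{φφ} : L = L : L`.
[cite: HertlingLarabi2026b, §4 Lemma 4.13 (4.8), chunk p0008] -/
theorem div_self_dualSubmodule (hnd : φ.Nondegenerate) (hφ : ∀ a b c : A, φ (a * b) c = φ a (b * c))
    {M : Submodule ℤ A} (hM : IsFullLattice A M) : φ.dualSubmodule M / φ.dualSubmodule M = M / M := by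
  rw [← dualSubmodule_mul hφ, mul_comm M, dualSubmodule_mul hφ, dualSubmodule_dualSubmodule hnd hφ hM]

/-- **LEMMA 4.13 (4.9) [Fa65-1]: `L·L^φ = 𝒪(L)^φ`** (dualise `(L·L^φ)^φ = 𝒪(L^φ) = 𝒪(L)`).
[cite: HertlingLarabi2026b, §4 Lemma 4.13 (4.9), chunk p0008] -/
theorem mul_dualSubmodule_eq (hnd : φ.Nondegenerate) (hφ : ∀ a b c : A, φ (a * b) c = φ a (b * c))
    {M : Submodule ℤ A} (hM : IsFullLattice A M) : M * φ.dualSubmodule M = φ.dualSubmodule (M / M) := by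
  rw [← dualSubmodule_dualSubmodule hnd hφ (isFullLattice_mul hM (isFullLattice_dualSubmodule hnd hM)),
    dualSubmodule_mul hφ, div_self_dualSubmodule hnd hφ hM]

/-- **`(uL)^φ = u⁻¹L^φ` for a unit `u`** — duality respects the `ε`-classes `[L]_ε = {uL}`.
[cite: HertlingLarabi2026b, §4 Def. 4.10 (c) with §2 («`ε`-classes»), chunk p0008] -/
theorem dualSubmodule_units_smul (hφ : ∀ a b c : A, φ (a * b) c = φ a (b * c)) (u : Aˣ) (M : Submodule ℤ A) :
    φ.dualSubmodule (u • M) = u⁻¹ • φ.dualSubmodule M := by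
  ext b
  rw [mem_units_smul_submodule_iff, inv_inv, LinearMap.BilinForm.mem_dualSubmodule,
    LinearMap.BilinForm.mem_dualSubmodule]
  constructor
  · intro h m hm
    have h1 := h (u • m) (Submodule.smul_mem_pointwise_smul m u M hm)
    have e : φ (u • b) m = φ b (u • m) := by
      rw [Units.smul_def, Units.smul_def, smul_eq_mul, smul_eq_mul, mul_comm (u : A) b, hφ]
    rw [e]
    exact h1
  · intro h y hy
    rw [mem_units_smul_submodule_iff] at hy
    have h1 := h _ hy
    have e : φ (u • b) ((u⁻¹ : Aˣ) • y) = φ b y := by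
      rw [Units.smul_def, Units.smul_def, smul_eq_mul, smul_eq_mul, mul_comm (u : A) b, hφ, ← mul_assoc,
        Units.mul_inv, one_mul]
    rw [← e]
    exact h1

/-! ## §3 Krull's lemma and Theorem 4.3 (b) for an `A` with a multiplicative metric -/

/-- **KRULL'S LEMMA [DTZ62] ∕ HL 2026 LEMMA 5.2 (c) for general `A`: `Λ·Λ ⊆ Λ` and `Λ·L = L` for a full lattice `L`
imply `1_A ∈ Λ`** («so `Λ` is an order») — Nakayama's lemma for the ideal `Λ` of the commutative ring
`ℤ·1 + Λ = Algebra.adjoin ℤ Λ ⊆ A` and its finitely generated module `L = ΛL`: some `r ≡ 1 (mod Λ)` kills `L`, which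
contains the unit `k·1_A`, so `r = 0` and `1 ∈ Λ` (the `Y`-version is `ComplexMultiplication.one_mem_of_mul_le_of_mul_eq`).
[cite: HertlingLarabi2026, §5 Lemma 5.2 (c) (Krull's lemma), chunk p0011] [cite: DadeTausskyZassenhaus1962, §1 (Krull's lemma, as cited)] -/
theorem one_mem_of_mul_le_of_mul_eq {Λ M : Submodule ℤ A} (hΛ : Λ * Λ ≤ Λ) (hM : IsFullLattice A M)
    (hΛM : Λ * M = M) : (1 : A) ∈ Λ := by
  -- the ring `R = ℤ·1 + Λ` and its ideal `Λ`
  let S : Subalgebra ℤ A := Algebra.adjoin ℤ (Λ : Set A)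
  haveI : IsScalarTower S S A := IsScalarTower.left _
  have hstab : ∀ r ∈ S, (∀ a ∈ Λ, r * a ∈ Λ) ∧ ∀ m ∈ M, r * m ∈ M := by
    intro r hr
    refine Algebra.adjoin_induction (fun x hx => ⟨fun a ha => hΛ (Submodule.mul_mem_mul hx ha), fun m hm => ?_⟩)
      (fun k => ⟨fun a ha => ?_, fun m hm => ?_⟩) (fun x y _ _ hx hy => ⟨fun a ha => ?_, fun m hm => ?_⟩)
      (fun x y _ _ hx hy => ⟨fun a ha => ?_, fun m hm => ?_⟩) hr
    · rw [← hΛM]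
      exact Submodule.mul_mem_mul hx hm
    · rw [Algebra.algebraMap_eq_smul_one, smul_mul_assoc, one_mul]
      exact Λ.smul_mem k ha
    · rw [Algebra.algebraMap_eq_smul_one, smul_mul_assoc, one_mul]
      exact M.smul_mem k hm
    · rw [add_mul]; exact Λ.add_mem (hx.1 a ha) (hy.1 a ha)
    · rw [add_mul]; exact M.add_mem (hx.2 m hm) (hy.2 m hm)
    · rw [mul_assoc]; exact hx.1 _ (hy.1 a ha)
    · rw [mul_assoc]; exact hx.2 _ (hy.2 m hm)
  let I : Ideal S :=
    { carrier := {r | (r : A) ∈ Λ}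
      add_mem' := fun {a b} ha hb => by
        change ((a : A) + b) ∈ Λ
        exact Λ.add_mem ha hb
      zero_mem' := Λ.zero_mem
      smul_mem' := fun r a ha => by
        change ((r : A) * a) ∈ Λ
        exact (hstab r r.2).1 _ ha }
  let N : Submodule S A :=
    { carrier := M
      add_mem' := fun ha hb => M.add_mem ha hb
      zero_mem' := M.zero_mem
      smul_mem' := fun r m hm => by
        change ((r : A) * m) ∈ M
        exact (hstab r r.2).2 m hm }
  -- `N` is finitely generated over `S` and `N ≤ I • N` (`M = ΛM`)
  have hNfg : N.FG := by
    obtain ⟨s, hs⟩ := hM.1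
    refine ⟨s, le_antisymm (Submodule.span_le.2 fun x hx => ?_) fun x hx => ?_⟩
    · change x ∈ M
      rw [← hs]
      exact Submodule.subset_span hx
    · have hx' : x ∈ Submodule.span ℤ (s : Set A) := by rw [hs]; exact hx
      exact Submodule.span_le_restrictScalars ℤ S (s : Set A) hx'
  have hIN : N ≤ I • N := by
    intro x hx
    have hx' : x ∈ Λ * M := by rw [hΛM]; exact hx
    refine Submodule.mul_induction_on hx' (fun a ha m hm => ?_) (fun x y hx hy => Submodule.add_mem _ hx hy)
    exact Submodule.smul_mem_smul (r := (⟨a, Algebra.subset_adjoin ha⟩ : S)) (n := m) ha hm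
  obtain ⟨r, hr1, hr0⟩ := Submodule.exists_sub_one_mem_and_smul_eq_zero_of_fg_of_le_smul I N hNfg hIN
  -- `r` kills the unit `k·1 ∈ M`, so `r = 0` and `1 = -(r - 1) ∈ Λ`
  obtain ⟨k, hk, hk1⟩ := hM.2 1
  have hku : IsUnit (k • (1 : A)) := by
    rw [zsmul_eq_mul, mul_one, ← map_intCast (algebraMap ℚ A) k]
    exact (((Int.cast_ne_zero (α := ℚ)).2 hk).isUnit).map _
  have hr : (r : A) = 0 := by
    have h0 : (r : A) * (k • (1 : A)) = 0 := hr0 _ hk1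
    exact (hku.mul_left_eq_zero).1 h0
  have h1 : ((r : A) - 1) ∈ Λ := hr1
  rw [hr, zero_sub] at h1
  simpa using Λ.neg_mem h1

omit [Algebra ℚ A] in
/-- **THEOREM 4.3 (b) (iii) ⟹ (iv), in any commutative ring: `L·(𝒪(L):L) = 𝒪(L)` implies `𝒪(𝒪(L):L) = 𝒪(L)`**
(«`L⁻¹ = 𝒪(L):L`, and `L⁻¹` is invertible with `𝒪(L⁻¹) = 𝒪(L)`»; the `Y`-version is
`ComplexMultiplication.div_div_self_of_mul_div_eq`). [cite: HertlingLarabi2026b, §4 Thm. 4.3 (b), chunk p0007] -/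
theorem div_div_div_eq_of_mul_div_div_eq {M : Submodule ℤ A} (h : M * ((M / M) / M) = M / M) :
    ((M / M) / M) / ((M / M) / M) = M / M := by
  refine le_antisymm (fun x hx => ?_) (fun x hx => ?_)
  · -- `x𝒪(L) = x·L·(𝒪(L):L) ⊆ L·(𝒪(L):L) = 𝒪(L)`, so `x = x·1 ∈ 𝒪(L)`
    rw [Submodule.mem_div_iff_forall_mul_mem] at hx
    have h1 : (1 : A) ∈ M * ((M / M) / M) := by rw [h]; exact one_mem_div_self M
    have hx1 : x * 1 ∈ M / M := by
      refine Submodule.mul_induction_on h1 (fun m hm p hp => ?_) (fun y z hy hz => ?_)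
      · rw [mul_left_comm, ← h]
        exact Submodule.mul_mem_mul hm (hx p hp)
      · rw [mul_add]
        exact Submodule.add_mem _ hy hz
    rwa [mul_one] at hx1
  · -- `𝒪(L)` multiplies `𝒪(L):L` into itself
    rw [Submodule.mem_div_iff_forall_mul_mem]
    intro p hp
    rw [Submodule.mem_div_iff_forall_mul_mem] at hp ⊢
    intro m hm
    have h1 := Submodule.mul_mem_mul hx (hp m hm)
    rwa [div_self_mul_div_self, ← mul_assoc] at h1

/-- **THEOREM 4.3 (b) (iv) ⟹ (iii) [Fa65-1] FOR EVERY `A` WITH A MULTIPLICATIVE METRIC (nilpotents allowed):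
`𝒪(𝒪(L):L) = 𝒪(L)` implies `L·(𝒪(L):L) = 𝒪(L)`** — Hertling–Larabi's proof of Thm. 5.6 (c) (v) ⟹ (i) with the
`φ`-dual in place of `L_3^{*ℤ} ⊂ A^*`: `L_1 := L(𝒪(L):L) ⊂ 𝒪(L)` satisfies `L_1² ⊂ L_1` (5.6) and
`𝒪(L) : L_1 = 𝒪(L)` (5.8, using (iv)), hence by (4.7) ∕ (4.4) `L_1·𝒪(L)^φ = 𝒪(L)^φ` (5.7), and Krull's lemma with
the full lattice `𝒪(L)^φ` gives `1 ∈ L_1`, `L_1 = 𝒪(L)`.  (Tree: `ComplexMultiplication.mul_div_div_eq_of_div_div_div_eq`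
for `Y = ∏ Lᵢ` under the trace form; `mul_div_div_eq_of_div_div_div_eq_of_isReduced` for reduced `A`.)
[cite: HertlingLarabi2026b, §4 Thm. 4.3 (b) (iv) ⟹ (i), chunk p0007] [cite: HertlingLarabi2026, §5 Thm. 5.6 (c) (v) ⟹ (i), chunk p0012]
[cite: Faddeev1965, as cited by HertlingLarabi2026b Thm. 4.3] -/
theorem mul_div_div_eq_of_div_div_div_eq (hnd : φ.Nondegenerate) (hφ : ∀ a b c : A, φ (a * b) c = φ a (b * c))
    {M : Submodule ℤ A} (hM : IsFullLattice A M) (hv : ((M / M) / M) / ((M / M) / M) = M / M) :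
    M * ((M / M) / M) = M / M := by
  have hO : IsFullLattice A (M / M) := isFullLattice_div hM hM
  have hle : M * ((M / M) / M) ≤ M / M := mul_div_div_le M
  -- `𝒪(L)L_1 = L_1`
  have hOL : (M / M) * (M * ((M / M) / M)) = M * ((M / M) / M) := by
    rw [← mul_assoc, div_self_mul_eq_self]
  -- (5.6) `L_1² ⊂ L_1`
  have h56 : (M * ((M / M) / M)) * (M * ((M / M) / M)) ≤ M * ((M / M) / M) :=
    calc (M * ((M / M) / M)) * (M * ((M / M) / M)) ≤ (M / M) * (M * ((M / M) / M)) := mul_le_mul' hle le_rfl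
      _ = M * ((M / M) / M) := hOL
  -- (5.8) `𝒪(L) : L_1 = 𝒪(L)` (uses (iv))
  have h58 : (M / M) / (M * ((M / M) / M)) = M / M := by
    refine le_antisymm (fun a ha => ?_) (Submodule.le_div_iff_mul_le.2 ?_)
    · rw [← hv, Submodule.mem_div_iff_forall_mul_mem]
      intro p hp
      rw [Submodule.mem_div_iff_forall_mul_mem]
      intro m hm
      rw [Submodule.mem_div_iff_forall_mul_mem] at ha
      have h1 := ha (m * p) (Submodule.mul_mem_mul hm hp)
      rwa [show a * (m * p) = a * p * m by ring] at h1
    · calc (M / M) * (M * ((M / M) / M)) ≤ (M / M) * (M / M) := mul_le_mul' le_rfl hle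
        _ = M / M := div_self_mul_div_self M
  -- (5.7) `L_1·𝒪(L)^φ = 𝒪(L)^φ`, by dualising (5.8)
  have hL : IsFullLattice A (M * ((M / M) / M)) := isFullLattice_mul hM (isFullLattice_div hO hM)
  have h57 : (M * ((M / M) / M)) * φ.dualSubmodule (M / M) = φ.dualSubmodule (M / M) := by
    have h1 : φ.dualSubmodule ((M * ((M / M) / M)) * φ.dualSubmodule (M / M)) = M / M := by
      rw [mul_comm (M * ((M / M) / M)) (φ.dualSubmodule (M / M)), dualSubmodule_mul hφ,
        dualSubmodule_dualSubmodule hnd hφ hO, h58]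
    rw [← dualSubmodule_dualSubmodule hnd hφ (isFullLattice_mul hL (isFullLattice_dualSubmodule hnd hO)), h1]
  -- Krull: `1 ∈ L_1`, so `L_1 = 𝒪(L)`
  have h1 : (1 : A) ∈ M * ((M / M) / M) :=
    one_mem_of_mul_le_of_mul_eq h56 (isFullLattice_dualSubmodule hnd hO) h57
  refine le_antisymm hle fun x hx => ?_
  rw [← hOL, ← mul_one x]
  exact Submodule.mul_mem_mul hx h1

/-- **THEOREM 4.3 (b) (iii) ⟺ (iv) for every `A` with a multiplicative metric:
`L·(𝒪(L):L) = 𝒪(L) ⟺ 𝒪(𝒪(L):L) = 𝒪(L)`** (with `FiniteQAlgebraLattice.mul_div_div_eq_of_exists_mul_eq_div_self`: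
(ii) ⟺ (iii) ⟺ (iv)). [cite: HertlingLarabi2026b, §4 Thm. 4.3 (b), chunk p0007] -/
theorem mul_div_div_eq_iff_div_div_div_eq (hnd : φ.Nondegenerate) (hφ : ∀ a b c : A, φ (a * b) c = φ a (b * c))
    {M : Submodule ℤ A} (hM : IsFullLattice A M) :
    M * ((M / M) / M) = M / M ↔ ((M / M) / M) / ((M / M) / M) = M / M :=
  ⟨div_div_div_eq_of_mul_div_div_eq, mul_div_div_eq_of_div_div_div_eq hnd hφ hM⟩

/-! ## §4 Theorem 4.14 -/

/-- **THEOREM 4.14, the order of `Λ^φ`: `𝒪(Λ^φ) = 𝒪(Λ) = Λ`** for an order `Λ` (by (4.8)); so «`Λ^φ` is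
invertible» reads `Λ^φ·(Λ : Λ^φ) = Λ`. [cite: HertlingLarabi2026b, §4 Thm. 4.14 (proof of (i) ⟹ (ii)), chunk p0008] -/
theorem div_self_dualSubmodule_eq_of_one_mem (hnd : φ.Nondegenerate)
    (hφ : ∀ a b c : A, φ (a * b) c = φ a (b * c)) {Λ : Submodule ℤ A} (h1 : (1 : A) ∈ Λ) (hΛΛ : Λ * Λ ≤ Λ)
    (hΛ : IsFullLattice A Λ) : φ.dualSubmodule Λ / φ.dualSubmodule Λ = Λ := by
  rw [div_self_dualSubmodule hnd hφ hΛ, div_self_eq_of_one_mem h1 hΛΛ]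

/-- **THEOREM 4.14 (i) ⟹ (ii): if every full lattice `L` with `𝒪(L) = Λ` is invertible, then `Λ^φ` is invertible**
(«`𝒪(Λ^φ) = 𝒪(Λ) = Λ`, so by (i) `Λ^φ` is invertible»). [cite: HertlingLarabi2026b, §4 Thm. 4.14 (i) ⟹ (ii), chunk p0008] -/
theorem dualSubmodule_mul_div_eq_of_forall_mul_div_eq (hnd : φ.Nondegenerate)
    (hφ : ∀ a b c : A, φ (a * b) c = φ a (b * c)) {Λ : Submodule ℤ A} (h1 : (1 : A) ∈ Λ) (hΛΛ : Λ * Λ ≤ Λ)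
    (hΛ : IsFullLattice A Λ) (H : ∀ M : Submodule ℤ A, IsFullLattice A M → M / M = Λ → M * (Λ / M) = Λ) :
    φ.dualSubmodule Λ * (Λ / φ.dualSubmodule Λ) = Λ :=
  H _ (isFullLattice_dualSubmodule hnd hΛ) (div_self_dualSubmodule_eq_of_one_mem hnd hφ h1 hΛΛ hΛ)

/-- **THEOREM 4.14 (ii) ⟹ (i): if `Λ^φ` is invertible, then every full lattice `L` with `𝒪(L) = Λ` is invertible**
— «`L(L^φ(Λ^φ)⁻¹) = Λ^φ(Λ^φ)⁻¹ = 𝒪(Λ^φ) = 𝒪(Λ) = Λ = 𝒪(L)`» by (4.9), (4.8), with `(Λ^φ)⁻¹ = Λ : Λ^φ`.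
[cite: HertlingLarabi2026b, §4 Thm. 4.14 (ii) ⟹ (i), chunk p0008] -/
theorem mul_div_eq_of_dualSubmodule_mul_div_eq (hnd : φ.Nondegenerate)
    (hφ : ∀ a b c : A, φ (a * b) c = φ a (b * c)) {Λ : Submodule ℤ A}
    (hii : φ.dualSubmodule Λ * (Λ / φ.dualSubmodule Λ) = Λ) {M : Submodule ℤ A} (hM : IsFullLattice A M)
    (hO : M / M = Λ) : M * (Λ / M) = Λ := by
  have hL₂ : M * (φ.dualSubmodule M * (Λ / φ.dualSubmodule Λ)) = M / M := by
    rw [← mul_assoc, mul_dualSubmodule_eq hnd hφ hM, hO, hii]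
  have h := mul_div_div_eq_of_exists_mul_eq_div_self ⟨_, hL₂⟩
  rwa [hO] at h

/-- **THEOREM 4.14 (i) ⟺ (ii)**: every full `L` with `𝒪(L) = Λ` is invertible iff `Λ^φ` is invertible.
[cite: HertlingLarabi2026b, §4 Thm. 4.14 (i) ⟺ (ii), chunk p0008] -/
theorem forall_mul_div_eq_iff_dualSubmodule_mul_div_eq (hnd : φ.Nondegenerate)
    (hφ : ∀ a b c : A, φ (a * b) c = φ a (b * c)) {Λ : Submodule ℤ A} (h1 : (1 : A) ∈ Λ) (hΛΛ : Λ * Λ ≤ Λ)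
    (hΛ : IsFullLattice A Λ) :
    (∀ M : Submodule ℤ A, IsFullLattice A M → M / M = Λ → M * (Λ / M) = Λ) ↔
      φ.dualSubmodule Λ * (Λ / φ.dualSubmodule Λ) = Λ :=
  ⟨dualSubmodule_mul_div_eq_of_forall_mul_div_eq hnd hφ h1 hΛΛ hΛ,
    fun hii _ hM hO => mul_div_eq_of_dualSubmodule_mul_div_eq hnd hφ hii hM hO⟩

/-- **THEOREM 4.14 (ii) ⟺ (iii): `Λ^φ` is invertible iff `𝒪((Λ^φ)²) = Λ`** — with `L_1 := Λ^φ`, `𝒪(L_1) = Λ`: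
`Λ^φΛ^φ = 𝒪(L_1)^φL_1 = (𝒪(L_1):L_1)^φ`, so `𝒪(Λ^φΛ^φ) = 𝒪(𝒪(L_1):L_1)` by (4.7) ∕ (4.8), and Theorem 4.3 (b)
(iii) ⟺ (iv) (§3, which in the non-separable case needs the metric) concludes.
[cite: HertlingLarabi2026b, §4 Thm. 4.14 (ii) ⟺ (iii), chunk p0008] -/
theorem dualSubmodule_mul_div_eq_iff_div_self_sq_eq (hnd : φ.Nondegenerate)
    (hφ : ∀ a b c : A, φ (a * b) c = φ a (b * c)) {Λ : Submodule ℤ A} (h1 : (1 : A) ∈ Λ) (hΛΛ : Λ * Λ ≤ Λ)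
    (hΛ : IsFullLattice A Λ) :
    φ.dualSubmodule Λ * (Λ / φ.dualSubmodule Λ) = Λ ↔
      (φ.dualSubmodule Λ * φ.dualSubmodule Λ) / (φ.dualSubmodule Λ * φ.dualSubmodule Λ) = Λ := by
  have hL : IsFullLattice A (φ.dualSubmodule Λ) := isFullLattice_dualSubmodule hnd hΛ
  have hOL : φ.dualSubmodule Λ / φ.dualSubmodule Λ = Λ := div_self_dualSubmodule_eq_of_one_mem hnd hφ h1 hΛΛ hΛ
  -- `Λ^φΛ^φ = (Λ : Λ^φ)^φ`, so `𝒪(Λ^φΛ^φ) = 𝒪(Λ : Λ^φ)`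
  have hsq : φ.dualSubmodule Λ * φ.dualSubmodule Λ = φ.dualSubmodule (Λ / φ.dualSubmodule Λ) := by
    rw [dualSubmodule_div hnd hφ hΛ hL]
  have hO2 : (φ.dualSubmodule Λ * φ.dualSubmodule Λ) / (φ.dualSubmodule Λ * φ.dualSubmodule Λ) =
      (Λ / φ.dualSubmodule Λ) / (Λ / φ.dualSubmodule Λ) := by
    rw [hsq, div_self_dualSubmodule hnd hφ (isFullLattice_div hΛ hL)]
  rw [hO2]
  -- Theorem 4.3 (b) (iii) ⟺ (iv) for `L_1 = Λ^φ`, `𝒪(L_1) = Λ`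
  have h43 := mul_div_div_eq_iff_div_div_div_eq hnd hφ hL
  rw [hOL] at h43
  exact h43

/-! ## §5 Cyclic algebras and cyclic orders: Remark 3.4 (ii), Lemma 4.11, Theorem 4.12 -/

section Cyclic

variable {a : A} {n : ℕ}

/-- **REMARK 3.4 (ii), the linear form `l` of a cyclic algebra:** on the power basis `e_i = a^i` (`0 ≤ i ≤ n`,
`n + 1 = dim A`) the last coordinate `l = e_n^*` has `l(a^m) = 0` for `m < n` and `l(a^n) = 1`.
[cite: HertlingLarabi2026b, §3 Rem. 3.4 (ii), chunk p0006] -/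
theorem coord_last_pow (e : Basis (Fin (n + 1)) ℚ A) (he : ∀ i, e i = a ^ (i : ℕ)) {m : ℕ} (hm : m ≤ n) :
    e.coord (Fin.last n) (a ^ m) = if m = n then 1 else 0 := by
  have h : a ^ m = e ⟨m, Nat.lt_succ_of_le hm⟩ := by rw [he]
  rw [h, Basis.coord_apply, Basis.repr_self, Finsupp.single_apply]
  simp [Fin.ext_iff]

/-- `l(x·a^d) = Σᵢ xᵢ·l(a^{i+d})` for `x = Σᵢ xᵢa^i` (bilinearity of `φ(x, y) = l(xy)` on the power basis).
[cite: HertlingLarabi2026b, §3 Rem. 3.4 (ii) with (3.2), chunk p0006] -/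
theorem coord_last_mul_pow (e : Basis (Fin (n + 1)) ℚ A) (he : ∀ i, e i = a ^ (i : ℕ)) (x : A) (d : ℕ) :
    e.coord (Fin.last n) (x * a ^ d) =
      ∑ i : Fin (n + 1), e.repr x i * e.coord (Fin.last n) (a ^ ((i : ℕ) + d)) := by
  conv_lhs => rw [← e.sum_repr x]
  rw [Finset.sum_mul, map_sum]
  refine Finset.sum_congr rfl fun i _ => ?_
  rw [he, smul_mul_assoc, ← pow_add, map_smul, smul_eq_mul]

/-- **REMARK 3.4 (ii): ANY CYCLIC ALGEBRA `A = ℚ[a]` HAS A MULTIPLICATIVE METRIC — `φ(x, y) = l(xy)` with `l = e_n^*`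
on the power basis `e_i = a^i` is nondegenerate**: if `φ(x, ·) = 0` and `x = Σ xᵢa^i ≠ 0` with top index `k`, then
`0 = φ(x, a^{n−k}) = x_k`. [cite: HertlingLarabi2026b, §3 Rem. 3.4 (ii), chunk p0006] -/
theorem nondegenerate_compr₂_coord_last (e : Basis (Fin (n + 1)) ℚ A) (he : ∀ i, e i = a ^ (i : ℕ)) :
    ((LinearMap.mul ℚ A).compr₂ (e.coord (Fin.last n))).Nondegenerate := by
  have happ : ∀ x y : A, (LinearMap.mul ℚ A).compr₂ (e.coord (Fin.last n)) x y = e.coord (Fin.last n) (x * y) :=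
    fun x y => rfl
  have hrefl : LinearMap.IsRefl ((LinearMap.mul ℚ A).compr₂ (e.coord (Fin.last n))) := fun x y h => by
    rw [happ, mul_comm, ← happ]
    exact h
  refine (LinearMap.IsRefl.nondegenerate_iff_separatingLeft hrefl).2 fun x hx => ?_
  by_contra hne
  have hs : (e.repr x).support.Nonempty := by
    rw [Finset.nonempty_iff_ne_empty, Ne, Finsupp.support_eq_empty]
    exact fun h => hne (e.repr.map_eq_zero_iff.1 h)
  have hkn : ((e.repr x).support.max' hs : ℕ) ≤ n := Nat.lt_succ_iff.1 ((e.repr x).support.max' hs).2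
  have hzero : ∀ i : Fin (n + 1), (e.repr x).support.max' hs < i → e.repr x i = 0 := fun i hi => by
    by_contra h
    exact absurd hi (not_lt.2 (Finset.le_max' _ i (Finsupp.mem_support_iff.2 h)))
  have h := hx (a ^ (n - (e.repr x).support.max' hs))
  rw [happ, coord_last_mul_pow e he, Finset.sum_eq_single ((e.repr x).support.max' hs)] at h
  · rw [Nat.add_sub_cancel' hkn, coord_last_pow e he le_rfl, if_pos rfl, mul_one] at h
    exact Finsupp.mem_support_iff.1 (Finset.max'_mem _ hs) h
  · intro i _ hik
    rcases lt_or_gt_of_ne hik with hlt | hgt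
    · have hlt' : (i : ℕ) < (e.repr x).support.max' hs := hlt
      rw [coord_last_pow e he (by omega), if_neg (by omega), mul_zero]
    · rw [hzero i hgt, zero_mul]
  · exact fun h => (h (Finset.mem_univ _)).elim

omit [Algebra ℚ A] in
/-- Integers form a subring: a rational in the image of `ℤ` is in the range subring, and conversely. [folklore] -/
private theorem mem_range_iff_mem_rangeS {q : ℚ} :
    q ∈ Set.range (algebraMap ℤ ℚ) ↔ q ∈ (algebraMap ℤ ℚ).range :=
  ⟨fun ⟨z, hz⟩ => RingHom.mem_range.2 ⟨z, hz⟩, fun h => RingHom.mem_range.1 h⟩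

/-- **LEMMA 4.11 (b): `Λ^φ = Λ` for `Λ = ⊕_{i=0}^{n} ℤa^i` closed under multiplication and `φ(x, y) = l(xy)`,
`l = e_n^*`** — `⊇`: `l(Λ) ⊂ ℤ` and `ΛΛ ⊂ Λ`; `⊆`: if `l(bΛ) ⊂ ℤ` then the coordinates `b_n, b_{n−1}, …, b_0` of `b`
are integers one after the other, since `l(b·a^d) = b_{n−d} + Σ_{j>n−d} b_j l(a^{j+d})` with `l(a^{j+d}) ∈ ℤ`
(`a^{j+d} = a^ja^d ∈ ΛΛ ⊂ Λ`). [cite: HertlingLarabi2026b, §4 Lemma 4.11 (b), chunk p0008] -/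
theorem dualSubmodule_span_pow_eq (e : Basis (Fin (n + 1)) ℚ A) (he : ∀ i, e i = a ^ (i : ℕ))
    (hmul : span ℤ (Set.range e) * span ℤ (Set.range e) ≤ span ℤ (Set.range e)) :
    LinearMap.BilinForm.dualSubmodule ((LinearMap.mul ℚ A).compr₂ (e.coord (Fin.last n))) (span ℤ (Set.range e)) =
      span ℤ (Set.range e) := by
  have happ : ∀ x y : A, (LinearMap.mul ℚ A).compr₂ (e.coord (Fin.last n)) x y = e.coord (Fin.last n) (x * y) :=
    fun x y => rfl
  -- the powers `a^m`, `m ≤ n`, and the products of two of them lie in `Λ`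
  have hpow : ∀ m ≤ n, a ^ m ∈ span ℤ (Set.range e) := fun m hm => by
    have : a ^ m = e ⟨m, Nat.lt_succ_of_le hm⟩ := by rw [he]
    rw [this]
    exact Submodule.subset_span (Set.mem_range_self _)
  have hpow2 : ∀ j d : ℕ, j ≤ n → d ≤ n → a ^ (j + d) ∈ span ℤ (Set.range e) := fun j d hj hd => by
    rw [pow_add]
    exact hmul (Submodule.mul_mem_mul (hpow j hj) (hpow d hd))
  -- `l(Λ) ⊂ ℤ`
  have hint : ∀ y ∈ span ℤ (Set.range e), e.coord (Fin.last n) y ∈ (algebraMap ℤ ℚ).range := fun y hy => by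
    obtain ⟨z, hz⟩ := (Basis.mem_span_iff_repr_mem ℤ e y).1 hy (Fin.last n)
    exact RingHom.mem_range.2 ⟨z, by rw [Basis.coord_apply]; exact hz⟩
  refine le_antisymm (fun b hb => ?_) (fun x hx => ?_)
  · -- `Λ^φ ⊆ Λ`: the coordinates of `b` are integers, from the top down
    rw [LinearMap.BilinForm.mem_dualSubmodule] at hb
    have hcoef : ∀ d : ℕ, ∀ i : Fin (n + 1), n < (i : ℕ) + d → e.repr b i ∈ (algebraMap ℤ ℚ).range := by
      intro d
      induction d with
      | zero =>
        intro i hi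
        have := i.2
        omega
      | succ d ih =>
        intro i hi
        by_cases hlt : n < (i : ℕ) + d
        · exact ih i hlt
        have hid : (i : ℕ) + d = n := by omega
        have hdn : d ≤ n := by omega
        -- `l(b·a^d) ∈ ℤ`
        obtain ⟨z, hz⟩ := Submodule.mem_one.1 (hb (a ^ d) (hpow d hdn))
        rw [happ, coord_last_mul_pow e he, ← Finset.add_sum_erase _ _ (Finset.mem_univ i), hid,
          coord_last_pow e he le_rfl, if_pos rfl, mul_one] at hz
        have hrest : ∑ j ∈ Finset.univ.erase i, e.repr b j * e.coord (Fin.last n) (a ^ ((j : ℕ) + d)) ∈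
            (algebraMap ℤ ℚ).range := by
          refine Subring.sum_mem _ fun j hj => ?_
          have hji : j ≠ i := by simpa using hj
          rcases lt_or_gt_of_ne hji with hji' | hji'
          · have hji'' : (j : ℕ) < i := hji'
            rw [coord_last_pow e he (by omega), if_neg (by omega), mul_zero]
            exact zero_mem _
          · have hji'' : (i : ℕ) < j := hji'
            have hjn : (j : ℕ) ≤ n := Nat.lt_succ_iff.1 j.2
            exact mul_mem (ih j (by omega)) (hint _ (hpow2 j d hjn hdn))
        have hbi : e.repr b i = algebraMap ℤ ℚ z -
            ∑ j ∈ Finset.univ.erase i, e.repr b j * e.coord (Fin.last n) (a ^ ((j : ℕ) + d)) := by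
          rw [hz, add_sub_cancel_right]
        rw [hbi]
        exact sub_mem (RingHom.mem_range.2 ⟨z, rfl⟩) hrest
    refine (Basis.mem_span_iff_repr_mem ℤ e b).2 fun i => ?_
    have := i.2
    exact mem_range_iff_mem_rangeS.2 (hcoef (n + 1 - i) i (by omega))
  · -- `Λ ⊆ Λ^φ`
    rw [LinearMap.BilinForm.mem_dualSubmodule]
    intro y hy
    obtain ⟨z, hz⟩ := RingHom.mem_range.1 (hint (x * y) (hmul (Submodule.mul_mem_mul hx hy)))
    exact Submodule.mem_one.2 ⟨z, by rw [happ]; exact hz⟩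

/-- **LEMMA 4.11 (a) (i): if `ℤ[a]` is a (cyclic) order of `A` — a full lattice — then `A` is cyclic, `A = ℚ[a]`.**
[cite: HertlingLarabi2026b, §4 Lemma 4.11 (a) (i), chunk p0008] -/
theorem adjoin_eq_top_of_isFullLattice_adjoin
    (ha : IsFullLattice A (Subalgebra.toSubmodule (Algebra.adjoin ℤ {a}))) : Algebra.adjoin ℚ {a} = ⊤ := by
  refine eq_top_iff.2 fun x _ => ?_
  obtain ⟨k, hk, hkx⟩ := ha.2 x
  rw [Subalgebra.mem_toSubmodule, Algebra.adjoin_singleton_eq_range_aeval, AlgHom.mem_range] at hkx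
  obtain ⟨p, hp⟩ := hkx
  have hx : x = (k : ℚ)⁻¹ • aeval a (p.map (algebraMap ℤ ℚ)) := by
    rw [aeval_map_algebraMap, hp, ← Int.cast_smul_eq_zsmul ℚ k x, smul_smul,
      inv_mul_cancel₀ (Int.cast_ne_zero.2 hk), one_smul]
  rw [hx]
  refine Subalgebra.smul_mem _ ?_ _
  rw [Algebra.adjoin_singleton_eq_range_aeval, AlgHom.mem_range]
  exact ⟨_, rfl⟩

variable [Module.Finite ℚ A]

/-- **LEMMA 4.11 (a) (ii): «any cyclic algebra `A` contains cyclic orders» — if `A = ℚ[a]` then `ℤ[ka]` is a full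
lattice (an order) for a suitable `k ∈ ℤ ∖ 0`** (`ka` integral over `ℤ`; `ℚ·ℤ[ka] = ℚ[ka] = ℚ[a] = A` by clearing
the denominators of a polynomial). [cite: HertlingLarabi2026b, §4 Lemma 4.11 (a) (ii), chunk p0008] -/
theorem exists_isFullLattice_adjoin_zsmul (h : Algebra.adjoin ℚ {a} = ⊤) :
    ∃ k : ℤ, k ≠ 0 ∧ IsFullLattice A (Subalgebra.toSubmodule (Algebra.adjoin ℤ {k • a})) := by
  obtain ⟨m, hm⟩ := IsIntegral.exists_multiple_integral_of_isLocalization (nonZeroDivisors ℤ) (Rₘ := ℚ) a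
    (Algebra.IsIntegral.isIntegral a)
  have hk : (m : ℤ) ≠ 0 := nonZeroDivisors.coe_ne_zero m
  have hint : IsIntegral ℤ ((m : ℤ) • a) := hm
  refine ⟨m, hk, hint.fg_adjoin_singleton, fun d => ?_⟩
  -- `ℚ[ka] = ℚ[a] = A`
  have htop : Algebra.adjoin ℚ {(m : ℤ) • a} = ⊤ := by
    refine eq_top_iff.2 (h.symm.le.trans (Algebra.adjoin_le (Set.singleton_subset_iff.2 ?_)))
    have ha : a = ((m : ℤ) : ℚ)⁻¹ • ((m : ℤ) • a) := by
      rw [← Int.cast_smul_eq_zsmul ℚ (m : ℤ) a, smul_smul, inv_mul_cancel₀ (Int.cast_ne_zero.2 hk), one_smul]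
    have hmem : ((m : ℤ) : ℚ)⁻¹ • ((m : ℤ) • a) ∈ Algebra.adjoin ℚ {(m : ℤ) • a} :=
      Subalgebra.smul_mem (Algebra.adjoin ℚ {(m : ℤ) • a}) (Algebra.self_mem_adjoin_singleton ℚ ((m : ℤ) • a)) _
    rw [← ha] at hmem
    exact hmem
  have hd : d ∈ Algebra.adjoin ℚ {(m : ℤ) • a} := by rw [htop]; exact Algebra.mem_top
  rw [Algebra.adjoin_singleton_eq_range_aeval, AlgHom.mem_range] at hd
  obtain ⟨p, rfl⟩ := hd
  obtain ⟨N, hN0, hN⟩ := IsLocalization.integerNormalization_spec (nonZeroDivisors ℤ) p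
  refine ⟨N, nonZeroDivisors.ne_zero hN0, ?_⟩
  rw [Subalgebra.mem_toSubmodule, Algebra.adjoin_singleton_eq_range_aeval, AlgHom.mem_range]
  refine ⟨IsLocalization.integerNormalization (nonZeroDivisors ℤ) p, ?_⟩
  rw [← aeval_map_algebraMap ℚ, hN, map_zsmul]

/-- **A cyclic order is `⊕_{i=0}^{n} ℤa^i` on a power basis of `A`**: if `ℤ[a]` is a full lattice then
`1, a, …, a^n` (`n + 1 = dim A`) is a `ℚ`-basis of `A = ℚ[a]` whose `ℤ`-span is `ℤ[a]` — `a` is integral over `ℤ`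
and by Gauss's lemma its `ℚ`-minimal polynomial, of degree `dim A`, has integer coefficients («`Λ = ℤ[a]` is a
cyclic order in `A`, then also `A` is cyclic»). [cite: HertlingLarabi2026b, §4 Def. 4.10 (a) and Lemma 4.11 (a) (i), chunk p0008] -/
theorem exists_basis_pow_span_eq [Nontrivial A]
    (ha : IsFullLattice A (Subalgebra.toSubmodule (Algebra.adjoin ℤ {a}))) :
    ∃ n : ℕ, ∃ e : Basis (Fin (n + 1)) ℚ A, (∀ i, e i = a ^ (i : ℕ)) ∧
      span ℤ (Set.range e) = Subalgebra.toSubmodule (Algebra.adjoin ℤ {a}) := by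
  have hint : IsIntegral ℚ a := Algebra.IsIntegral.isIntegral a
  have htop : Algebra.adjoin ℚ {a} = ⊤ := adjoin_eq_top_of_isFullLattice_adjoin ha
  let pb := PowerBasis.ofAdjoinEqTop hint htop
  have hgen : pb.gen = a := PowerBasis.ofAdjoinEqTop_gen hint htop
  obtain ⟨n, hn⟩ : ∃ n, pb.dim = n + 1 := ⟨pb.dim - 1, (Nat.succ_pred_eq_of_pos pb.dim_pos).symm⟩
  let e : Basis (Fin (n + 1)) ℚ A := pb.basis.reindex (finCongr hn)
  have he : ∀ i, e i = a ^ (i : ℕ) := fun i => by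
    simp only [e, Basis.reindex_apply, pb.basis_eq_pow, hgen, finCongr_symm, finCongr_apply, Fin.val_cast]
  refine ⟨n, e, he, le_antisymm (Submodule.span_le.2 ?_) fun x hx => ?_⟩
  · rintro _ ⟨i, rfl⟩
    rw [he]
    exact Subalgebra.pow_mem _ (Algebra.self_mem_adjoin_singleton ℤ a) _
  -- `ℤ[a] ⊆ ⊕ ℤa^i`: the `ℚ`-minimal polynomial of `a` is a monic INTEGER polynomial of degree `n + 1` (Gauss)
  have hintZ : IsIntegral ℤ a := IsIntegral.of_mem_of_fg _ ha.1 a (Algebra.self_mem_adjoin_singleton ℤ a)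
  have hdvd : minpoly ℚ a ∣ (minpoly ℤ a).map (algebraMap ℤ ℚ) :=
    minpoly.dvd ℚ a (by rw [aeval_map_algebraMap, minpoly.aeval])
  obtain ⟨g, hg⟩ := IsIntegrallyClosed.eq_map_mul_C_of_dvd ℚ (minpoly.monic hintZ) hdvd
  rw [(minpoly.monic hint).leadingCoeff, C_1, mul_one] at hg
  have hgm : g.Monic := by
    rw [(algebraMap ℤ ℚ).injective_int.monic_map_iff, hg]
    exact minpoly.monic hint
  have hgdeg : g.natDegree = n + 1 := by
    rw [← natDegree_map_eq_of_injective (algebraMap ℤ ℚ).injective_int g, hg, ← hn]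
    exact (PowerBasis.ofAdjoinEqTop_dim hint htop).symm
  have haeval : aeval a g = 0 := by
    rw [← aeval_map_algebraMap ℚ, hg, minpoly.aeval]
  -- `a^{n+1} ∈ ⊕ ℤa^i`
  have hpow : a ^ (n + 1) ∈ span ℤ (Set.range e) := by
    have h1 := hgm.as_sum
    rw [hgdeg] at h1
    have h3 := haeval
    rw [h1, map_add, map_pow, aeval_X, map_sum] at h3
    simp only [map_mul, aeval_C, map_pow, aeval_X] at h3
    rw [add_eq_zero_iff_eq_neg] at h3
    rw [h3]
    refine Submodule.neg_mem _ (Submodule.sum_mem _ fun i hi => ?_)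
    rw [← Algebra.smul_def]
    refine Submodule.smul_mem _ _ ?_
    have hi' : i < n + 1 := Finset.mem_range.1 hi
    have : a ^ i = e ⟨i, hi'⟩ := by rw [he]
    rw [this]
    exact Submodule.subset_span (Set.mem_range_self _)
  -- `⊕ ℤa^i` is stable under multiplication by `a`, hence contains all powers of `a`
  have hstab : ∀ x ∈ span ℤ (Set.range e), a * x ∈ span ℤ (Set.range e) := by
    intro x hx
    refine Submodule.span_induction (fun y hy => ?_) (by simp) (fun y z _ _ hy hz => ?_)
      (fun z y _ hy => ?_) hx
    · obtain ⟨i, rfl⟩ := hy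
      rw [he, ← pow_succ']
      by_cases hi : (i : ℕ) + 1 < n + 1
      · have : a ^ ((i : ℕ) + 1) = e ⟨i + 1, hi⟩ := by rw [he]
        rw [this]
        exact Submodule.subset_span (Set.mem_range_self _)
      · have := i.2
        have hi' : (i : ℕ) + 1 = n + 1 := by omega
        rw [hi']
        exact hpow
    · rw [mul_add]
      exact Submodule.add_mem _ hy hz
    · rw [mul_smul_comm]
      exact Submodule.smul_mem _ _ hy
  have hpow_mem : ∀ k : ℕ, a ^ k ∈ span ℤ (Set.range e) := fun k => by
    induction k with
    | zero =>
      have h0 : a ^ 0 = e 0 := by rw [he]; rfl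
      rw [h0]
      exact Submodule.subset_span (Set.mem_range_self _)
    | succ k ih =>
      rw [pow_succ']
      exact hstab _ ih
  rw [Subalgebra.mem_toSubmodule, Algebra.adjoin_singleton_eq_range_aeval, AlgHom.mem_range] at hx
  obtain ⟨p, rfl⟩ := hx
  rw [aeval_eq_sum_range]
  exact Submodule.sum_mem _ fun i _ => Submodule.smul_mem _ _ (hpow_mem i)

omit [Module.Finite ℚ A] in
/-- **LEMMA 4.11 (b) as printed: for a cyclic order `Λ = ℤ[a] = ⊕_{i=0}^{n} ℤa^i` the metric `φ(x, y) = l(xy)` induced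
by the linear form `l = e_n^*` of Remark 3.4 (ii) satisfies `Λ^φ = Λ`.**
[cite: HertlingLarabi2026b, §4 Lemma 4.11 (b), chunk p0008] -/
theorem dualSubmodule_adjoin_eq (e : Basis (Fin (n + 1)) ℚ A) (he : ∀ i, e i = a ^ (i : ℕ))
    (hΛ : span ℤ (Set.range e) = Subalgebra.toSubmodule (Algebra.adjoin ℤ {a})) :
    LinearMap.BilinForm.dualSubmodule ((LinearMap.mul ℚ A).compr₂ (e.coord (Fin.last n)))
        (Subalgebra.toSubmodule (Algebra.adjoin ℤ {a})) =
      Subalgebra.toSubmodule (Algebra.adjoin ℤ {a}) := by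
  have hmul : span ℤ (Set.range e) * span ℤ (Set.range e) ≤ span ℤ (Set.range e) := by
    rw [hΛ]
    exact Submodule.mul_le.2 fun x hx y hy => Subalgebra.mul_mem _ hx hy
  rw [← hΛ]
  exact dualSubmodule_span_pow_eq e he hmul

/-- **THEOREM 4.12: over a CYCLIC order every full lattice is invertible — if `Λ = ℤ[a]` is an order of `A` (a full
lattice) and `L` is a full lattice with `𝒪(L) = Λ`, then `L·(Λ:L) = Λ`** («In the case of separable `A`, Theorem 4.12
is due to Faddeev [Fa65-1]. The general case follows from Lemma 4.11 (b) and Theorem 4.14 (ii)⟹(i).»: with the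
metric `φ` of Lemma 4.11 (b), `Λ^φ = Λ` is invertible, `Λ·(Λ:Λ) = ΛΛ = Λ`.)
[cite: HertlingLarabi2026b, §4 Thm. 4.12, chunk p0008] [cite: Faddeev1965, as cited by HertlingLarabi2026b Thm. 4.12 (separable case)] -/
theorem mul_div_eq_of_div_self_eq_adjoin (ha : IsFullLattice A (Subalgebra.toSubmodule (Algebra.adjoin ℤ {a})))
    {M : Submodule ℤ A} (hM : IsFullLattice A M) (hO : M / M = Subalgebra.toSubmodule (Algebra.adjoin ℤ {a})) :
    M * (Subalgebra.toSubmodule (Algebra.adjoin ℤ {a}) / M) = Subalgebra.toSubmodule (Algebra.adjoin ℤ {a}) := by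
  rcases subsingleton_or_nontrivial A with hA | hA
  · haveI := (Submodule.subsingleton_iff ℤ).2 hA
    exact Subsingleton.elim _ _
  obtain ⟨n, e, he, hΛ⟩ := exists_basis_pow_span_eq ha
  have h1 : (1 : A) ∈ Subalgebra.toSubmodule (Algebra.adjoin ℤ {a}) := Subalgebra.one_mem _
  have hΛΛ : Subalgebra.toSubmodule (Algebra.adjoin ℤ {a}) * Subalgebra.toSubmodule (Algebra.adjoin ℤ {a}) ≤
      Subalgebra.toSubmodule (Algebra.adjoin ℤ {a}) :=
    Submodule.mul_le.2 fun x hx y hy => Subalgebra.mul_mem _ hx hy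
  -- the multiplicative metric `φ(x, y) = l(xy)` of Lemma 4.11 (b): nondegenerate, `Λ^φ = Λ`
  have hφ := compr₂_mul_map_mul (e.coord (Fin.last n))
  have hnd := nondegenerate_compr₂_coord_last e he
  have hdual := dualSubmodule_adjoin_eq e he hΛ
  -- Theorem 4.14 (ii): `Λ^φ·(Λ:Λ^φ) = Λ·(Λ:Λ) = ΛΛ = Λ`
  have hii : LinearMap.BilinForm.dualSubmodule ((LinearMap.mul ℚ A).compr₂ (e.coord (Fin.last n)))
        (Subalgebra.toSubmodule (Algebra.adjoin ℤ {a})) *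
      (Subalgebra.toSubmodule (Algebra.adjoin ℤ {a}) /
        LinearMap.BilinForm.dualSubmodule ((LinearMap.mul ℚ A).compr₂ (e.coord (Fin.last n)))
          (Subalgebra.toSubmodule (Algebra.adjoin ℤ {a}))) =
      Subalgebra.toSubmodule (Algebra.adjoin ℤ {a}) := by
    rw [hdual, div_self_eq_of_one_mem h1 hΛΛ, mul_self_eq_of_one_mem h1 hΛΛ]
  exact mul_div_eq_of_dualSubmodule_mul_div_eq hnd hφ hii hM hO

/-- **THEOREM 4.12 in the form `L·(𝒪(L):L) = 𝒪(L)`**: a full lattice whose order is a cyclic order `ℤ[a]` is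
invertible. [cite: HertlingLarabi2026b, §4 Thm. 4.12, chunk p0008] -/
theorem mul_div_div_eq_of_div_self_eq_adjoin
    (ha : IsFullLattice A (Subalgebra.toSubmodule (Algebra.adjoin ℤ {a}))) {M : Submodule ℤ A}
    (hM : IsFullLattice A M) (hO : M / M = Subalgebra.toSubmodule (Algebra.adjoin ℤ {a})) :
    M * ((M / M) / M) = M / M := by
  rw [hO]
  exact mul_div_eq_of_div_self_eq_adjoin ha hM hO

end Cyclic

end Literature.NumberTheory.ComplexMultiplication.FiniteQAlgebraLattice
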